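import Mathlib.MeasureTheory.Integral.Bochner.ContinuousLinearMap
import Mathlib.MeasureTheory.Function.ContinuousMapDense
import Mathlib.Analysis.SpecialFunctions.Complex.Log
import Mathlib.Analysis.SpecialFunctions.Trigonometric.Bounds
import Mathlib.MeasureTheory.Measure.Haar.OfBasis
import Mathlib.MeasureTheory.Measure.Lebesgue.Complex
import Mathlib.Analysis.SpecialFunctions.Complex.Arg
import Literature.Probability.RandomPlanarGeometry.HexParafermion
import HarnessLib

/-!
# Crux `HexConjecture` (stmt-CriticalPhenomena-0808), line `root-locality-replaces-loewner`,
stub `stub_avoidanceCocycle`, step (b): the two limit functionals on a root bump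

Landing target:
`Summits/CriticalPhenomena/SAWScalingLimit/Theorems/SAWDevelopingMapHexConjectureAvoidanceCocycleIntegral.lean`
(`--supports stmt-CriticalPhenomena-0808`).

Continuum half of the ratio computation of `stub_avoidanceCocycle`.  Let `ψ ≥ 0`, `ψ ≢ 0`, be a
continuous bump supported in a set `B` on which (i) the phase of the kernel
`g = exp ((5/8)(L - Lb))` of Duminil-Copin–Smirnov's Conjecture 2 is coherent,
`|Im L - Im L(z_r)| ≤ 3/2` (angular localisation, `…AvoidanceCocycleRootPhase`), and (ii) the bulk
ratio `q` of the kernels of the hull subdomain and of the domain is within `η` of its limit `q₀`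
at the root (`…AvoidanceCocyclePackage`).  Then the two limit functionals
`I = ∫ ψ g`, `I' = ∫ ψ g q` satisfy

  `I ≠ 0`,  `(|q₀| - 2η) |I| ≤ |I'| ≤ (|q₀| + 2η) |I|`

(`norm_integral_bounds`): `|I| ≥ (1/2) ∫ ψ |g|` because `cos (15/16) ≥ 1/2`, and
`|I' - q₀ I| ≤ η ∫ ψ |g|`.  The file also carries the elementary geometry of the root balls
`B(i r, r/4)` (`ball_I_mul_geometry`: `|arg w - π/2| ≤ π/6` there) and two elementary lemmas of the
lattice assembly (a real squeeze and the transfer of non-emptiness of walk spaces to a larger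
domain).
-/

noncomputable section

open scoped Topology Real
open Filter Set Metric Complex MeasureTheory

namespace Summit.CriticalPhenomena.SAWScalingLimit.Theorems.HexConjecture.RootLocality.Cocycle

/-! ### Continuity and integrability of bump-weighted kernels -/

/-- A compactly supported continuous weight times a function continuous on an open set containing
the support of the weight is continuous. [folklore] -/
theorem continuous_mul_of_tsupport_subset {U : Set ℂ} (hU : IsOpen U) {f : ℂ → ℂ}
    (hf : Continuous f) (hfU : tsupport f ⊆ U) {g : ℂ → ℂ} (hg : ContinuousOn g U) :
    Continuous fun z => f z * g z := by
  refine continuous_iff_continuousAt.2 fun z => ?_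
  by_cases hz : z ∈ U
  · exact hf.continuousAt.mul (hg.continuousAt (hU.mem_nhds hz))
  · have hz' : z ∉ tsupport f := fun h => hz (hfU h)
    have hev : (fun w => f w * g w) =ᶠ[𝓝 z] fun _ => 0 := by
      filter_upwards [notMem_tsupport_iff_eventuallyEq.1 hz'] with w hw
      rw [hw, Pi.zero_apply, zero_mul]
    exact (continuousAt_const.congr hev.symm)

/-- The support of the complexified weight is the support of the weight. [folklore] -/
theorem tsupport_ofReal_comp (ψ : ℂ → ℝ) : tsupport (fun z => (ψ z : ℂ)) = tsupport ψ := by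
  rw [tsupport, tsupport]
  congr 1
  exact Function.support_comp_eq (fun x : ℝ => (x : ℂ)) (fun {x} => Complex.ofReal_eq_zero) ψ

/-- `cos t ≥ 1/2` for `|t| ≤ 15/16`. [folklore] -/
theorem one_half_le_cos {t : ℝ} (ht : |t| ≤ 15 / 16) : 1 / 2 ≤ Real.cos t := by
  have h1 := Real.one_sub_sq_div_two_le_cos (x := t)
  have h2 : t ^ 2 ≤ (15 / 16) ^ 2 := by
    rw [← sq_abs]; exact pow_le_pow_left₀ (abs_nonneg t) ht 2
  linarith

/-! ### The two functionals -/

/-- **Bounds for the two limit functionals on a root bump.**  With `g = exp ((5/8)(L - Lb))`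
continuous on an open `U`, a ratio function `q` continuous on `U` with `|q - q₀| ≤ η` on
`B ⊆ U`, a reference point `zr` with `|Im L(z) - Im L(zr)| ≤ 3/2` on `B`, and a continuous
compactly supported weight `ψ ≥ 0`, `ψ ≢ 0`, supported in `B`: the functional `I = ∫ ψ g` is
non-zero and `I' = ∫ ψ g q` satisfies `(|q₀| - 2η)|I| ≤ |I'| ≤ (|q₀| + 2η)|I|`. [folklore] -/
theorem norm_integral_bounds {U : Set ℂ} (hU : IsOpen U) {L : ℂ → ℂ} (hL : ContinuousOn L U)
    (Lb : ℂ) {q : ℂ → ℂ} (hq : ContinuousOn q U) {q₀ : ℂ} {η : ℝ} (hη : 0 ≤ η) {B : Set ℂ}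
    (hBU : B ⊆ U) (hqB : ∀ z ∈ B, ‖q z - q₀‖ ≤ η) {zr : ℂ}
    (hphase : ∀ z ∈ B, |(L z).im - (L zr).im| ≤ 3 / 2)
    {ψ : ℂ → ℝ} (hψc : Continuous ψ) (hψs : HasCompactSupport ψ) (hψ0 : ∀ z, 0 ≤ ψ z)
    (hψne : ∃ z, ψ z ≠ 0) (hψB : tsupport ψ ⊆ B) :
    (∫ z, (ψ z : ℂ) * exp ((5 / 8 : ℂ) * (L z - Lb))) ≠ 0 ∧
      (‖q₀‖ - 2 * η) * ‖∫ z, (ψ z : ℂ) * exp ((5 / 8 : ℂ) * (L z - Lb))‖ ≤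
        ‖∫ z, (ψ z : ℂ) * (exp ((5 / 8 : ℂ) * (L z - Lb)) * q z)‖ ∧
      ‖∫ z, (ψ z : ℂ) * (exp ((5 / 8 : ℂ) * (L z - Lb)) * q z)‖ ≤
        (‖q₀‖ + 2 * η) * ‖∫ z, (ψ z : ℂ) * exp ((5 / 8 : ℂ) * (L z - Lb))‖ := by
  -- notation
  set g : ℂ → ℂ := fun z => exp ((5 / 8 : ℂ) * (L z - Lb)) with hg
  set ψc : ℂ → ℂ := fun z => (ψ z : ℂ) with hψcdef
  have hψcc : Continuous ψc := continuous_ofReal.comp hψc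
  have hψcsupp : tsupport ψc = tsupport ψ := tsupport_ofReal_comp ψ
  have hψcs : HasCompactSupport ψc := by
    rw [HasCompactSupport, hψcsupp]; exact hψs
  have hψcU : tsupport ψc ⊆ U := hψcsupp ▸ hψB.trans hBU
  have hgc : ContinuousOn g U := (continuousOn_const.mul (hL.sub continuousOn_const)).cexp
  have hg0 : ∀ z, g z ≠ 0 := fun z => exp_ne_zero _
  have hgnorm : ∀ z, ‖g z‖ = Real.exp ((5 / 8 : ℂ) * (L z - Lb)).re := fun z => norm_exp _
  -- the integrands are continuous with compact support, hence integrable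
  have hc1 : Continuous fun z => ψc z * g z := continuous_mul_of_tsupport_subset hU hψcc hψcU hgc
  have hc2 : Continuous fun z => ψc z * (g z * q z) :=
    continuous_mul_of_tsupport_subset hU hψcc hψcU (hgc.mul hq)
  have hc4 : Continuous fun z => ψc z * (g z * (q z - q₀)) :=
    continuous_mul_of_tsupport_subset hU hψcc hψcU (hgc.mul (hq.sub continuousOn_const))
  have hc3 : Continuous fun z => ψ z * ‖g z‖ := by
    have h := continuous_re.comp (continuous_mul_of_tsupport_subset hU hψcc hψcU
      (continuous_ofReal.comp_continuousOn hgc.norm))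
    refine h.congr fun z => ?_
    simp [hψcdef]
  have hi1 : Integrable (fun z => ψc z * g z) := hc1.integrable_of_hasCompactSupport hψcs.mul_right
  have hi2 : Integrable (fun z => ψc z * (g z * q z)) :=
    hc2.integrable_of_hasCompactSupport hψcs.mul_right
  have hi4 : Integrable (fun z => ψc z * (g z * (q z - q₀))) :=
    hc4.integrable_of_hasCompactSupport hψcs.mul_right
  have hi3 : Integrable (fun z => ψ z * ‖g z‖) := hc3.integrable_of_hasCompactSupport hψs.mul_right
  -- outside `B` the weight vanishes
  have hψout : ∀ z, z ∉ B → ψ z = 0 := fun z hz =>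
    image_eq_zero_of_notMem_tsupport fun h => hz (hψB h)
  -- the positive mass `P = ∫ ψ |g|`
  set P : ℝ := ∫ z, ψ z * ‖g z‖ with hP
  have hP0 : 0 < P := by
    rw [hP, integral_pos_iff_support_of_nonneg (fun z => mul_nonneg (hψ0 z) (norm_nonneg _)) hi3]
    obtain ⟨z₀, hz₀⟩ := hψne
    have hsupp : (Function.support fun z => ψ z * ‖g z‖) = Function.support ψ := by
      ext z
      simp only [Function.mem_support, ne_eq, mul_eq_zero, norm_eq_zero, hg0 z, or_false]
    rw [hsupp]
    exact (hψc.isOpen_support).measure_pos volume ⟨z₀, hz₀⟩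
  -- the real number `5/8` inside `ℂ`
  have h58 : ∀ w : ℂ, ((5 / 8 : ℂ) * w).im = 5 / 8 * w.im := fun w => by
    rw [show (5 / 8 : ℂ) = ((5 / 8 : ℝ) : ℂ) by push_cast; ring, im_ofReal_mul]
  -- `|I| ≥ P/2` by angular localisation
  set I : ℂ := ∫ z, ψc z * g z with hI
  set θr : ℝ := ((5 / 8 : ℂ) * (L zr - Lb)).im with hθr
  set v : ℂ := exp (-((θr : ℂ) * Complex.I)) with hv
  have hvnorm : ‖v‖ = 1 := by
    rw [hv, norm_exp]
    simp
  have hre : ∀ z, (v * (ψc z * g z)).re =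
      ψ z * (Real.exp ((5 / 8 : ℂ) * (L z - Lb)).re *
        Real.cos (((5 / 8 : ℂ) * (L z - Lb)).im - θr)) := by
    intro z
    have h1 : v * (ψc z * g z) = ψc z * exp ((5 / 8 : ℂ) * (L z - Lb) - (θr : ℂ) * Complex.I) := by
      rw [hg, hv, sub_eq_add_neg, Complex.exp_add]
      ring
    rw [h1, hψcdef]
    simp only
    rw [re_ofReal_mul, exp_re]
    congr 2
    · simp
    · simp
  have hcos : ∀ z ∈ B, 1 / 2 ≤ Real.cos (((5 / 8 : ℂ) * (L z - Lb)).im - θr) := by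
    intro z hz
    apply one_half_le_cos
    have h1 : ((5 / 8 : ℂ) * (L z - Lb)).im - θr = 5 / 8 * ((L z).im - (L zr).im) := by
      rw [hθr, h58, h58, sub_im, sub_im]; ring
    rw [h1, abs_mul, abs_of_pos (by norm_num : (0 : ℝ) < 5 / 8)]
    linarith [hphase z hz]
  have hpt : ∀ z, ψ z * ‖g z‖ / 2 ≤ (v * (ψc z * g z)).re := by
    intro z
    rw [hre z, hgnorm z]
    by_cases hz : z ∈ B
    · have h1 := hcos z hz
      have h2 : 0 ≤ ψ z * Real.exp ((5 / 8 : ℂ) * (L z - Lb)).re :=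
        mul_nonneg (hψ0 z) (Real.exp_pos _).le
      nlinarith
    · rw [hψout z hz]; simp
  have hlow : P / 2 ≤ ‖I‖ := by
    have h1 : (v * I).re = ∫ z, (v * (ψc z * g z)).re := by
      rw [hI, ← integral_const_mul]
      have h := integral_re (hi1.const_mul v)
      simp only [RCLike.re_to_complex] at h
      exact h.symm
    have h2 : ∫ z, ψ z * ‖g z‖ / 2 ≤ ∫ z, (v * (ψc z * g z)).re := by
      refine integral_mono (hi3.div_const 2) ?_ hpt
      have h := (hi1.const_mul v).re
      simpa only [RCLike.re_to_complex] using h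
    have h3 : ∫ z, ψ z * ‖g z‖ / 2 = P / 2 := by
      rw [hP, ← integral_div]
    calc P / 2 = ∫ z, ψ z * ‖g z‖ / 2 := h3.symm
      _ ≤ (v * I).re := h1 ▸ h2
      _ ≤ ‖v * I‖ := re_le_norm _
      _ = ‖I‖ := by rw [norm_mul, hvnorm, one_mul]
  have hI0 : I ≠ 0 := norm_pos_iff.1 (by linarith)
  -- `|I' - q₀ I| ≤ η P`
  set I' : ℂ := ∫ z, ψc z * (g z * q z) with hI'
  have hdiff : ‖I' - q₀ * I‖ ≤ η * P := by
    have h1 : I' - q₀ * I = ∫ z, ψc z * (g z * (q z - q₀)) := by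
      rw [hI', hI, ← integral_const_mul, ← integral_sub hi2 (hi1.const_mul q₀)]
      congr 1
      funext z
      ring
    have h2 : ∀ z, ‖ψc z * (g z * (q z - q₀))‖ ≤ ψ z * ‖g z‖ * η := by
      intro z
      by_cases hz : z ∈ B
      · rw [norm_mul, norm_mul, hψcdef]
        simp only [norm_real, Real.norm_of_nonneg (hψ0 z)]
        have := hqB z hz
        have h0 : 0 ≤ ψ z * ‖g z‖ := mul_nonneg (hψ0 z) (norm_nonneg _)
        nlinarith [norm_nonneg (q z - q₀)]
      · rw [hψcdef]
        simp [hψout z hz]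
    rw [h1]
    calc ‖∫ z, ψc z * (g z * (q z - q₀))‖ ≤ ∫ z, ‖ψc z * (g z * (q z - q₀))‖ :=
          norm_integral_le_integral_norm _
      _ ≤ ∫ z, ψ z * ‖g z‖ * η := integral_mono hi4.norm (hi3.mul_const η) h2
      _ = η * P := by rw [integral_mul_const, hP, mul_comm]
  -- conclusion
  have hP2 : P ≤ 2 * ‖I‖ := by linarith
  have hq₀I : ‖q₀ * I‖ = ‖q₀‖ * ‖I‖ := norm_mul _ _
  refine ⟨hI0, ?_, ?_⟩
  · have h1 : ‖q₀ * I‖ - ‖I' - q₀ * I‖ ≤ ‖I'‖ := by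
      have := norm_sub_norm_le (q₀ * I) I'
      rw [← norm_neg (q₀ * I - I'), neg_sub] at this
      linarith
    nlinarith [norm_nonneg I]
  · have h1 : ‖I'‖ ≤ ‖q₀ * I‖ + ‖I' - q₀ * I‖ := by
      have := norm_add_le (q₀ * I) (I' - q₀ * I)
      rwa [add_sub_cancel] at this
    nlinarith [norm_nonneg I]

/-! ### Elementary geometry of the balls `B(i r, r/4)` -/

/-- `arcsin (1/2) = π/6`. [folklore] -/
theorem arcsin_one_half : Real.arcsin (1 / 2) = π / 6 := by
  rw [← Real.sin_pi_div_six, Real.arcsin_sin] <;> linarith [Real.pi_pos]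

/-- A complex number in the ball `B(1, 1/3)` has argument at most `π/6` in absolute value.
[folklore] -/
theorem abs_arg_le_of_mem_ball_one {u : ℂ} (hu : u ∈ ball (1 : ℂ) (1 / 3)) :
    |arg u| ≤ π / 6 := by
  rw [mem_ball, dist_eq_norm] at hu
  have hre : 2 / 3 < u.re := by
    have h := abs_re_le_norm (u - 1)
    rw [sub_re, one_re] at h
    have := (abs_lt.1 (h.trans_lt hu)).1
    linarith
  have him : |u.im| < 1 / 3 := by
    have h := abs_im_le_norm (u - 1)
    rw [sub_im, one_im, sub_zero] at h
    exact h.trans_lt hu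
  have hnorm : 2 / 3 < ‖u‖ := hre.trans_le (re_le_norm u)
  have hn0 : 0 < ‖u‖ := by linarith
  have hq : |u.im / ‖u‖| ≤ 1 / 2 := by
    rw [abs_div, abs_of_pos hn0, div_le_iff₀ hn0]
    linarith
  rw [arg_of_re_nonneg (by linarith), ← arcsin_one_half]
  obtain ⟨hq1, hq2⟩ := abs_le.1 hq
  refine abs_le.2 ⟨?_, Real.arcsin_le_arcsin hq2⟩
  rw [← Real.arcsin_neg]
  exact Real.arcsin_le_arcsin (by linarith)

/-- For `w ∈ B(i r, r/4)` (`r > 0`): `w ∈ ℍ`, `‖w‖ < 5r/4`, `w ≠ 0` and `|arg w - π/2| ≤ π/6`.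
[folklore] -/
theorem ball_I_mul_geometry {r : ℝ} (hr : 0 < r) {w : ℂ} (hw : w ∈ ball ((r : ℂ) * I) (r / 4)) :
    0 < w.im ∧ ‖w‖ < 5 * r / 4 ∧ w ≠ 0 ∧ |arg w - π / 2| ≤ π / 6 := by
  rw [mem_ball, dist_eq_norm] at hw
  have him : 3 * r / 4 < w.im := by
    have h := abs_im_le_norm (w - r * I)
    have : (w - r * I).im = w.im - r := by simp
    rw [this] at h
    have := (abs_lt.1 (h.trans_lt hw)).1
    linarith
  have him0 : 0 < w.im := by linarith
  have hnorm : ‖w‖ < 5 * r / 4 := by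
    calc ‖w‖ = ‖(w - r * I) + r * I‖ := by rw [sub_add_cancel]
      _ ≤ ‖w - r * I‖ + ‖(r : ℂ) * I‖ := norm_add_le _ _
      _ < r / 4 + r := by
          refine add_lt_add_of_lt_of_le hw ?_
          rw [norm_mul, norm_I, mul_one, norm_real, Real.norm_of_nonneg hr.le]
      _ = 5 * r / 4 := by ring
  have hw0 : w ≠ 0 := fun h => by rw [h, zero_im] at him0; exact lt_irrefl _ him0
  -- `u = -i w / r ∈ B(1, 1/3)` and `w = i · (r u)`
  set u : ℂ := -I * w / r with hu
  have hr0 : (r : ℂ) ≠ 0 := by exact_mod_cast hr.ne'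
  have hwu : w = I * ((r : ℂ) * u) := by
    rw [hu]; field_simp; ring_nf; rw [I_sq]; ring
  have huball : u ∈ ball (1 : ℂ) (1 / 3) := by
    rw [mem_ball, dist_eq_norm]
    have : u - 1 = -I * (w - r * I) / r := by
      rw [hu]; field_simp; ring_nf; rw [I_sq]; ring
    rw [this, norm_div, norm_mul, norm_neg, norm_I, one_mul, norm_real, Real.norm_of_nonneg hr.le,
      div_lt_iff₀ hr]
    linarith
  have hu0 : u ≠ 0 := by
    intro h0
    rw [h0, mem_ball, dist_eq_norm, zero_sub, norm_neg, norm_one] at huball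
    linarith
  have hargu := abs_arg_le_of_mem_ball_one huball
  have hru : arg ((r : ℂ) * u) = arg u := arg_real_mul u hr
  have hru0 : (r : ℂ) * u ≠ 0 := mul_ne_zero hr0 hu0
  have hsum : arg I + arg ((r : ℂ) * u) ∈ Set.Ioc (-π) π := by
    rw [arg_I, hru]
    obtain ⟨h1, h2⟩ := abs_le.1 hargu
    constructor <;> linarith [Real.pi_pos]
  have hargw : arg w = π / 2 + arg u := by
    rw [hwu, (arg_mul_eq_add_arg_iff I_ne_zero hru0).2 hsum, arg_I, hru]
  refine ⟨him0, hnorm, hw0, ?_⟩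
  rw [hargw, add_sub_cancel_left]
  exact hargu

/-! ### Two elementary lemmas for the lattice assembly -/

section Lattice

open Literature.Probability.LatticeModels (HexVertex)
open Literature.Probability.RandomPlanarGeometry.SAW

/-- A real function squeezed eventually between bounds arbitrarily close to `c` tends to `c`.
[folklore] -/
theorem tendsto_of_eventually_between {l : Filter ℝ} {f : ℝ → ℝ} {c : ℝ}
    (h : ∀ ε : ℝ, 0 < ε → ∃ lo hi : ℝ, c - ε < lo ∧ hi < c + ε ∧ ∀ᶠ x in l, lo ≤ f x ∧ f x ≤ hi) :
    Tendsto f l (𝓝 c) := by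
  rw [Metric.tendsto_nhds]
  intro ε hε
  obtain ⟨lo, hi, hlo, hhi, hev⟩ := h ε hε
  filter_upwards [hev] with x hx
  rw [Real.dist_eq, abs_lt]
  constructor <;> linarith [hx.1, hx.2]

/-- The walks of a smaller domain are walks of the larger one: non-emptiness transfers.
[cite: LawlerSchrammWerner2004SAW, §3.4 ("SAW satisfies restriction")] -/
theorem nonempty_hexMidEdgeSAW_of_subset {Λ Λ' : Finset HexVertex} {sa sb : Sym2 HexVertex}
    (h : Λ' ⊆ Λ) (hne : Nonempty (HexMidEdgeSAW Λ' sa sb)) : Nonempty (HexMidEdgeSAW Λ sa sb) := by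
  obtain ⟨γ⟩ := hne
  exact ⟨⟨γ.verts, fun v hv => h (γ.subset v hv), γ.nodup, γ.isChain, γ.head_mem, γ.getLast_mem,
    γ.eq_of_nil, γ.edges_nodup, ⟨γ.fst_mem.1, γ.fst_mem.2.imp fun v hv => ⟨hv.1, h hv.2⟩⟩⟩⟩

end Lattice

/-- **Registered form `stub_avoidanceCocycle_integral`** (crux item stmt-CriticalPhenomena-0808, line
`root-locality-replaces-loewner`, stub `stub_avoidanceCocycle`, step (b)): bounds for the two limit
functionals on a root bump (`norm_integral_bounds`). [folklore] -/
theorem stub_avoidanceCocycle_integral : ∀ (U : Set ℂ) (L q : ℂ → ℂ) (Lb q₀ zr : ℂ) (η : ℝ) (B : Set ℂ) (ψ : ℂ → ℝ), IsOpen U → ContinuousOn L U → ContinuousOn q U → 0 ≤ η → B ⊆ U → (∀ z ∈ B, ‖q z - q₀‖ ≤ η) → (∀ z ∈ B, |(L z).im - (L zr).im| ≤ 3 / 2) → Continuous ψ → HasCompactSupport ψ → (∀ z, 0 ≤ ψ z) → (∃ z, ψ z ≠ 0) → tsupport ψ ⊆ B → (∫ z, (ψ z : ℂ) * Complex.exp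 ((5 / 8 : ℂ) * (L z - Lb))) ≠ 0 ∧ (‖q₀‖ - 2 * η) * ‖∫ z, (ψ z : ℂ) * Complex.exp ((5 / 8 : ℂ) * (L z - Lb))‖ ≤ ‖∫ z, (ψ z : ℂ) * (Complex.exp ((5 / 8 : ℂ) * (L z - Lb)) * q z)‖ ∧ ‖∫ z, (ψ z : ℂ) * (Complex.exp ((5 / 8 : ℂ) * (L z - Lb)) * q z)‖ ≤ (‖q₀‖ + 2 * η) * ‖∫ z, (ψ z : ℂ) * Complex.exp ((5 / 8 : ℂ) * (L z - Lb))‖ :=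
  fun _ _ _ Lb _ _ _ _ _ hU hL hq hη hBU hqB hphase hψc hψs hψ0 hψne hψB =>
    norm_integral_bounds hU hL Lb hq hη hBU hqB hphase hψc hψs hψ0 hψne hψB

end Summit.CriticalPhenomena.SAWScalingLimit.Theorems.HexConjecture.RootLocality.Cocycle

end
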